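import Literature.Geometry.Riemannian.RicciDeTurckSystemOperators
import HarnessLib

/-!
# The Ricci–DeTurck flow as a quasilinear system for vector-valued maps: structure theorem
(topic `Geometry/Riemannian`)

Third layer (after `MetricAssembly.lean`, `RicciDeTurckSystemOperators.lean`) of the reduction
of short-time existence of the Ricci–DeTurck flow on a closed manifold (hypothesis `hRE` of
`ricciFlow_shortTime_existence_of_ricciDeTurck`; Topping 2006, §5.2, Step 1; DeTurck 1983) to
the short-time existence theorem for quasilinear strictly parabolic systems for PLAIN
vector-valued maps on a closed manifold (Taylor, *PDE III*, Ch. 15, §7; Mantegazza–Martinazzi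
2012, Thm. 1.1 and the remark on systems, p. 858). For the vector-valued system
`𝒫 U = 𝒟₀ U + ℰ(rdtForm (𝒜U) h) - ℰ(𝒜(𝒟₀ U))` of `RicciDeTurckSystemOperators.lean` this file
defines, for every point `z` (chart `φ_z = extChartAt I z`), EXPLICIT coefficient functions of
the first-order jet `(y, w, p) ∈ E × W × (E →L W)`,

* `ChartCover.aCoef z (y, w, p) i i' = gⁱ'ⁱ`, the inverse Gram matrix of the components
  `coeffCLM z (φ_z⁻¹ y) w` of the assembled form `𝒜` in the chart at `z`;
* `ChartCover.fCoef z (y, w, p) ∈ W`, a polynomial expression in `w`, `p`, the inverse Gram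
  matrix and smooth functions of `y` (the coefficient map of the chart and its first two
  derivatives, the background Christoffel symbols `bgChris` and their derivatives, the tangent
  coordinate changes to the charts of the cover and the second derivatives of the transition
  maps, the functions `ρₖ`),

and PROVES

* `ChartCover.P_chart` — **the structure theorem**: for every admissible `C^∞` map `U` and
  every `y` in the chart target,
  `𝒫 U (φ_z⁻¹ y) = ∑ᵢᵢ' aCoef z (jet) i i' • D²(U ∘ φ_z⁻¹)(y)(bᵢ, bᵢ') + fCoef z (jet)`,
  `jet = (y, U(φ_z⁻¹ y), D(U ∘ φ_z⁻¹)(y))`: `𝒫` is a quasilinear second-order operator whose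
  principal part is the SCALAR operator `gᵖ𐞥 ∂ₚ∂_q` of the metric `𝒜 U` acting componentwise
  (the principal parts of the two `ℰ`-terms cancel: DeTurck's strict parabolicity
  `σ = |ξ|²_g · id`, Topping 2006, §5.2, Step 1, transported to the vector-valued system);
* `ChartCover.contDiffOn_aCoef`, `ChartCover.contDiffOn_fCoef` — the coefficients are `C^∞`
  on the open jet domain `{(y, w, p) | y ∈ φ_z.target, (φ_z⁻¹ y, w) admissible}`;
* `ChartCover.aCoef_symm`, `ChartCover.aCoef_pos` — the principal coefficient matrix is
  symmetric and positive definite there (strict parabolicity).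

These are exactly the structural hypotheses of the quasilinear short-time existence theorem in
the form consumed by `RicciDeTurckShortTime.lean`. Everything is proved; no named fact and no
`sorry` is introduced.

## References

* P. Topping, *Lectures on the Ricci flow*, LMS LNS 325 (2006), §5.2, Step 1. [Topping2006]
* D. M. DeTurck, Deforming metrics in the direction of their Ricci tensors, J. Differential
  Geom. 18 (1983) 157–162. [DeTurck1983]
* M. E. Taylor, *Partial differential equations III. Nonlinear equations*, 2nd ed., Applied
  Math. Sciences 117, Springer 2011, Ch. 15, §7. [TaylorPDEIII2011]
* C. Mantegazza, L. Martinazzi, A note on quasilinear parabolic equations on manifolds,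
  Ann. Sc. Norm. Super. Pisa Cl. Sci. (5) 11 (2012) 857–874, Thm. 1.1. [MantegazzaMartinazzi2012]
-/

noncomputable section

set_option maxSynthPendingDepth 3

open Bundle Set Function Filter ContinuousLinearMap TopologicalSpace
open scoped Manifold ContDiff Topology Matrix

namespace Literature.Geometry.Riemannian

open Lorentzian Lorentzian.OpensChart Lorentzian.PseudoRiemannianMetric
open Literature.Geometry.Riemannian.OpensChart

namespace ChartCover

variable {E : Type*} [NormedAddCommGroup E] [NormedSpace ℝ E] {H : Type*} [TopologicalSpace H]
  {I : ModelWithCorners ℝ E H} {M : Type*} [TopologicalSpace M] [ChartedSpace H M]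
  [IsManifold I ∞ M] {N : ℕ} (𝒞 : ChartCover I M N)
  {ι : Type*} [Fintype ι] [DecidableEq ι] (b : Module.Basis ι ℝ E)
  (h : PseudoRiemannianMetric I ∞ E (TangentSpace I : M → Type _))

/-! ### The coefficient functions of the jet -/

section Coefficients

variable [FiniteDimensional ℝ E]

/-- The coefficient map of the chart at `z` read on the chart target:
`𝔞_z(y) = coeffCLM z (φ_z⁻¹ y)`, a `C^∞` family of linear maps `W →L V` on the target
(`contDiffOn_coeffCLM_symm`); the components of `𝒜 U` in the chart at `z` are `𝔞_z(y)[U(φ_z⁻¹ y)]`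
(`chartRep_eq_coeffCLM`). [folklore] -/
def coeffFun (z : M) (y : E) :
    (Fin N → (E →L[ℝ] E →L[ℝ] ℝ)) →L[ℝ] (E →L[ℝ] E →L[ℝ] ℝ) :=
  𝒞.coeffCLM z ((extChartAt I z).symm y)

/-- The components `G = 𝔞_z(y) w` of the assembled form of the value `w` in the chart at `z`.
[folklore] -/
def gComp (z : M) (j : E × (Fin N → (E →L[ℝ] E →L[ℝ] ℝ)) × (E →L[ℝ] (Fin N → (E →L[ℝ] E →L[ℝ] ℝ)))) :
    E →L[ℝ] E →L[ℝ] ℝ :=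
  𝒞.coeffFun z j.1 j.2.1

/-- **The principal coefficient matrix** `a(y, w, p) i i' = gⁱ'ⁱ`, the inverse Gram matrix in the
basis `b` of the components of the assembled form in the chart at `z` (independent of `p`).
[folklore] -/
def aCoef (z : M) (j : E × (Fin N → (E →L[ℝ] E →L[ℝ] ℝ)) × (E →L[ℝ] (Fin N → (E →L[ℝ] E →L[ℝ] ℝ))))
    (i i' : ι) : ℝ :=
  gramInv b (𝒞.gComp z j) i' i

/-- The first derivative of the components through the jet:
`DG = 𝔞_z(y) ∘ p + (D𝔞_z(y))ᵀ w` (`fderiv_clmFamily_apply`). [folklore] -/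
def dG (z : M) (j : E × (Fin N → (E →L[ℝ] E →L[ℝ] ℝ)) × (E →L[ℝ] (Fin N → (E →L[ℝ] E →L[ℝ] ℝ)))) :
    E →L[ℝ] (E →L[ℝ] E →L[ℝ] ℝ) :=
  (𝒞.coeffFun z j.1).comp j.2.2 + (fderiv ℝ (𝒞.coeffFun z) j.1).flip j.2.1

/-- The non-principal part of the second derivative of the components through the jet:
`(D𝔞 bᵢ)(p bᵢ') + (D𝔞 bᵢ')(p bᵢ) + (D²𝔞(bᵢ, bᵢ')) w` (`fderiv_fderiv_clmFamily_apply`). [folklore] -/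
def d2GExtra (z : M) (j : E × (Fin N → (E →L[ℝ] E →L[ℝ] ℝ)) × (E →L[ℝ] (Fin N → (E →L[ℝ] E →L[ℝ] ℝ))))
    (i i' : ι) : E →L[ℝ] E →L[ℝ] ℝ :=
  fderiv ℝ (𝒞.coeffFun z) j.1 (b i) (j.2.2 (b i')) + fderiv ℝ (𝒞.coeffFun z) j.1 (b i') (j.2.2 (b i))
    + fderiv ℝ (fderiv ℝ (𝒞.coeffFun z)) j.1 (b i) (b i') j.2.1

/-- The lower-order part of the coordinate Ricci–DeTurck operator through the jet, as an element
of `V = E →L E →L ℝ`: the bilinear form with components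
`rdtLower b G g⁻¹ DG Γ̃ DΓ̃ (b_c, b_d)` (`rdtLower`, `RicciDeTurckCoord.lean`; `bilinOfCoeffs`).
[cite: AndrewsHopper2011, §5.4.1, (5.6)–(5.9)] -/
def rdtLowerV (z : M) (j : E × (Fin N → (E →L[ℝ] E →L[ℝ] ℝ)) × (E →L[ℝ] (Fin N → (E →L[ℝ] E →L[ℝ] ℝ)))) :
    E →L[ℝ] E →L[ℝ] ℝ :=
  bilinOfCoeffs b fun c d ↦
    rdtLower b (𝒞.gComp z j) (gramInv b (𝒞.gComp z j)) (𝒞.dG z j) (bgChris I b h z j.1)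
      (fun V Y₁ X₁ ↦ fderiv ℝ (fun y' : E ↦ bgChris I b h z y' Y₁ X₁) j.1 V) (b c) (b d)

/-- The contraction of the non-principal second-order terms: `∑ᵢᵢ' gⁱ'ⁱ · d2GExtra i i'`.
[folklore] -/
def principalExtra (z : M)
    (j : E × (Fin N → (E →L[ℝ] E →L[ℝ] ℝ)) × (E →L[ℝ] (Fin N → (E →L[ℝ] E →L[ℝ] ℝ)))) :
    E →L[ℝ] E →L[ℝ] ℝ :=
  ∑ i, ∑ i', gramInv b (𝒞.gComp z j) i' i • 𝒞.d2GExtra b z j i i'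

/-- The correction vector of `𝒟₀` in the chart at `z` through the jet:
`cz = ∑ₖ ρₖ(x)² cvec k z G x`, `x = φ_z⁻¹ y` (`D0_eq_lap_add`). [folklore] -/
def czVec (z : M) (j : E × (Fin N → (E →L[ℝ] E →L[ℝ] ℝ)) × (E →L[ℝ] (Fin N → (E →L[ℝ] E →L[ℝ] ℝ)))) :
    E :=
  ∑ k, (𝒞.ρ k ((extChartAt I z).symm j.1)) ^ 2 •
    𝒞.cvec b k z (𝒞.gComp z j) ((extChartAt I z).symm j.1)

/-- **The lower-order coefficient** `f(y, w, p) ∈ W` of the structure theorem: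
`f_k = (p c_z)_k + ρₖ(x) · pullCLM Aₖ [principalExtra + rdtLowerV - 𝔞_z(y)(p c_z)]`, `Aₖ` the
tangent coordinate change from the chart at `cₖ` to the chart at `z` at `x = φ_z⁻¹ y`.
[folklore] -/
def fCoef (z : M) (j : E × (Fin N → (E →L[ℝ] E →L[ℝ] ℝ)) × (E →L[ℝ] (Fin N → (E →L[ℝ] E →L[ℝ] ℝ)))) :
    Fin N → (E →L[ℝ] E →L[ℝ] ℝ) :=
  fun k ↦ j.2.2 (𝒞.czVec b z j) k +
    𝒞.ρ k ((extChartAt I z).symm j.1) •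
      pullCLM (tangentCoordChange I (𝒞.center k) z ((extChartAt I z).symm j.1))
        (𝒞.principalExtra b z j + 𝒞.rdtLowerV b h z j - 𝒞.coeffFun z j.1 (j.2.2 (𝒞.czVec b z j)))

end Coefficients

/-! ### The structure theorem -/

section Structure

variable [I.Boundaryless] [FiniteDimensional ℝ E] [CompleteSpace E] [h.HasLeviCivita]

omit [CompleteSpace E] [FiniteDimensional ℝ E] in
/-- The chart expression of an admissible map is `C²` at the points of the chart target, and the
coefficient map is `C²` there. [folklore] -/
theorem contDiffAt_chartData {U : M → Fin N → (E →L[ℝ] E →L[ℝ] ℝ)} (hU : 𝒞.Adm U) (z : M)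
    {y : E} (hy : y ∈ (extChartAt I z).target) :
    ContDiffAt ℝ 2 (U ∘ (extChartAt I z).symm) y ∧ ContDiffAt ℝ 2 (𝒞.coeffFun z) y := by
  have hx : (extChartAt I z).symm y ∈ (chartAt H z).source := by
    rw [← _root_.extChartAt_source I]
    exact (extChartAt I z).map_target hy
  have h2 : (2 : ℕ∞ω) ≤ ∞ := WithTop.coe_le_coe.mpr le_top
  refine ⟨?_, ?_⟩
  · have h1 := contDiffAt_comp_extChartAt_symm (z := z)
      ((hU.1.of_le h2).contMDiffAt (x := (extChartAt I z).symm y)) hx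
    rwa [(extChartAt I z).right_inv hy] at h1
  · exact ((𝒞.contDiffOn_coeffCLM_symm z).of_le h2).contDiffAt
      ((isOpen_extChartAt_target z).mem_nhds hy)

/-- **The Ricci–DeTurck form of the assembled metric, read in the chart at `z`, through the
jet.** For an admissible `U`, `y` in the chart target, `x = φ_z⁻¹ y` and
`jet = (y, U x, D(U ∘ φ_z⁻¹)(y))`:
`(rdtForm (𝒜U) h)_x (e_z⁻¹ ·, e_z⁻¹ ·) = 𝔞_z(y)[lap z U x] + principalExtra (jet) + rdtLowerV (jet)`
— the coordinate formula `rdtForm_trivSymmL_eq_chartRHS` with the representative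
`G = 𝔞_z[U ∘ φ_z⁻¹]` (`chartRep_eq_coeffCLM`) expanded by the product rules
`fderiv_clmFamily_apply`, `fderiv_fderiv_clmFamily_apply`; the principal part
`∑ gʲⁱ D²G(bᵢ, bⱼ)` becomes `𝔞_z(y)` applied to the chart Laplacian plus first-order terms.
[cite: AndrewsHopper2011, §5.4.1, (5.6)–(5.9)] [cite: Topping2006, §5.2, Step 1] -/
theorem pullCLM_trivSymmL_rdtForm {U : M → Fin N → (E →L[ℝ] E →L[ℝ] ℝ)} (hU : 𝒞.Adm U) (z : M)
    {y : E} (hy : y ∈ (extChartAt I z).target) :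
    haveI := (𝒞.metricOf U hU).hasLeviCivita
    pullCLM (trivSymmL I z ((extChartAt I z).symm y))
        (rdtForm (𝒞.metricOf U hU) h ((extChartAt I z).symm y)) =
      𝒞.coeffFun z y (𝒞.lap b z U ((extChartAt I z).symm y)) +
        𝒞.principalExtra b z (y, U ((extChartAt I z).symm y), fderiv ℝ (U ∘ (extChartAt I z).symm) y) +
        𝒞.rdtLowerV b h z (y, U ((extChartAt I z).symm y), fderiv ℝ (U ∘ (extChartAt I z).symm) y) := by
  haveI := (𝒞.metricOf U hU).hasLeviCivita
  set g := 𝒞.metricOf U hU with hg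
  have hyx : extChartAt I z ((extChartAt I z).symm y) = y := (extChartAt I z).right_inv hy
  obtain ⟨hu2, ha2⟩ := 𝒞.contDiffAt_chartData hU z hy
  have h2 : (2 : ℕ∞ω) ≠ 0 := two_ne_zero
  -- the representative of `g` in the chart at `z`
  have hrep : chartRep I (fun _ ↦ g) z 0 =
      fun y' ↦ 𝒞.coeffFun z y' ((U ∘ (extChartAt I z).symm) y') :=
    funext fun y' ↦ 𝒞.chartRep_eq_coeffCLM (g := g) (U := U) (fun _ ↦ rfl) z 0 y'
  have hD1 : fderiv ℝ (chartRep I (fun _ ↦ g) z 0) y =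
      𝒞.dG z (y, U ((extChartAt I z).symm y), fderiv ℝ (U ∘ (extChartAt I z).symm) y) := by
    rw [hrep, fderiv_clm_apply (ha2.differentiableAt h2) (hu2.differentiableAt h2)]
    rfl
  have hD2 : ∀ i j, fderiv ℝ (fderiv ℝ (chartRep I (fun _ ↦ g) z 0)) y (b i) (b j) =
      𝒞.coeffFun z y (fderiv ℝ (fderiv ℝ (U ∘ (extChartAt I z).symm)) y (b i) (b j)) +
        𝒞.d2GExtra b z (y, U ((extChartAt I z).symm y), fderiv ℝ (U ∘ (extChartAt I z).symm) y)
          i j := by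
    intro i j
    rw [hrep, fderiv_fderiv_clmFamily_apply ha2 hu2, d2GExtra]
    simp only [comp_apply, add_assoc]
  have hG0 : chartRep I (fun _ ↦ g) z 0 y =
      𝒞.gComp z (y, U ((extChartAt I z).symm y), fderiv ℝ (U ∘ (extChartAt I z).symm) y) := by
    rw [hrep]
    rfl
  -- compare the two sides on pairs of basis vectors
  refine clm₂_ext_basis b fun c d ↦ ?_
  rw [pullCLM_apply]
  refine (rdtForm_trivSymmL_eq_chartRHS g h b z hy (b c) (b d)).trans ?_
  rw [chartRHS, chartLower, hD1, hG0]
  simp only [hD2]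
  rw [_root_.add_apply, _root_.add_apply, _root_.add_apply, _root_.add_apply, rdtLowerV,
    bilinOfCoeffs_basis, principalExtra, lap, hyx, map_sum, _root_.sum_apply, _root_.sum_apply,
    _root_.sum_apply, _root_.sum_apply, ← Finset.sum_add_distrib]
  congr 1
  refine Finset.sum_congr rfl fun i _ ↦ ?_
  rw [map_sum, _root_.sum_apply, _root_.sum_apply, _root_.sum_apply, _root_.sum_apply,
    ← Finset.sum_add_distrib]
  refine Finset.sum_congr rfl fun j _ ↦ ?_
  rw [map_smul, _root_.smul_apply, _root_.smul_apply, _root_.smul_apply, _root_.smul_apply,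
    _root_.add_apply, _root_.add_apply, smul_eq_mul, smul_eq_mul, mul_add]
  rfl

/-- **Structure theorem: the vector-valued Ricci–DeTurck system is quasilinear with scalar
principal part.** For an admissible `C^∞` map `U`, a point `z` and `y` in the target of the
chart at `z`, with `jet = (y, U(φ_z⁻¹ y), D(U ∘ φ_z⁻¹)(y))`:
`𝒫 U (φ_z⁻¹ y) = ∑ᵢᵢ' aCoef z jet i i' • D²(U ∘ φ_z⁻¹)(y)(bᵢ, bᵢ') + fCoef z jet`, where
`aCoef z jet i i' = gⁱ'ⁱ` is the inverse metric of `𝒜 U` in the chart — the principal part is the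
scalar operator `gᵖ𐞥 ∂ₚ∂_q` acting componentwise on `W`. Proof: `𝒟₀ U = lap z U + p[c_z]`
(`D0_eq_lap_add`); the two `ℰ`-terms are `ρₖ · pullCLM Aₖ` applied to
`𝔞_z(y)[lap z U] + principalExtra + rdtLowerV` (`pullCLM_trivSymmL_rdtForm`) and to
`𝔞_z(y)[𝒟₀ U]` (`pullCLM_trivSymmL_assembleAt`), whose principal parts `𝔞_z(y)[lap z U]` cancel
(DeTurck's trick makes the symbol `|ξ|²_g · id`, Topping 2006, §5.2, Step 1; here transported to
the vector-valued system). [cite: Topping2006, §5.2, Step 1] [cite: DeTurck1983] -/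
theorem P_chart {U : M → Fin N → (E →L[ℝ] E →L[ℝ] ℝ)} (hU : 𝒞.Adm U) (z : M)
    {y : E} (hy : y ∈ (extChartAt I z).target) :
    𝒞.P b h U ((extChartAt I z).symm y) =
      (∑ i, ∑ i', 𝒞.aCoef b z (y, U ((extChartAt I z).symm y), fderiv ℝ (U ∘ (extChartAt I z).symm) y)
          i i' • fderiv ℝ (fderiv ℝ (U ∘ (extChartAt I z).symm)) y (b i) (b i')) +
        𝒞.fCoef b h z (y, U ((extChartAt I z).symm y), fderiv ℝ (U ∘ (extChartAt I z).symm) y) := by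
  haveI := (𝒞.metricOf U hU).hasLeviCivita
  set g := 𝒞.metricOf U hU with hg
  set x := (extChartAt I z).symm y with hxdef
  have hx : x ∈ (chartAt H z).source := by
    rw [← _root_.extChartAt_source I]
    exact (extChartAt I z).map_target hy
  have hyx : extChartAt I z x = y := (extChartAt I z).right_inv hy
  have h2 : (2 : ℕ∞ω) ≤ ∞ := WithTop.coe_le_coe.mpr le_top
  have hU2 : ContMDiffAt I 𝓘(ℝ, Fin N → (E →L[ℝ] E →L[ℝ] ℝ)) 2 U x := (hU.1.of_le h2).contMDiffAt
  -- `𝒟₀` in the chart at `z`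
  have hD0 : 𝒞.D0 b U x = 𝒞.lap b z U x + fderiv ℝ (U ∘ (extChartAt I z).symm) y
      (𝒞.czVec b z (y, U x, fderiv ℝ (U ∘ (extChartAt I z).symm) y)) := by
    rw [𝒞.D0_eq_lap_add b g (U := U) (x := x) rfl hx hU2, hyx]
    rfl
  have hlap : 𝒞.lap b z U x = ∑ i, ∑ i', 𝒞.aCoef b z (y, U x, fderiv ℝ (U ∘ (extChartAt I z).symm) y)
      i i' • fderiv ℝ (fderiv ℝ (U ∘ (extChartAt I z).symm)) y (b i) (b i') := by
    simp only [lap, hyx]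
    rfl
  -- the two `ℰ`-terms
  have hrdt := 𝒞.pullCLM_trivSymmL_rdtForm b h hU z hy
  rw [𝒞.P_eq_of_adm b h hU]
  funext k
  simp only [Pi.add_apply, Pi.sub_apply]
  -- the difference of the two `ℰ`-terms, componentwise
  have hdiff : 𝒞.embed (rdtForm g h) x k - 𝒞.embed (𝒞.assemble (𝒞.D0 b U)) x k =
      𝒞.ρ k x • pullCLM (tangentCoordChange I (𝒞.center k) z x)
        (𝒞.principalExtra b z (y, U x, fderiv ℝ (U ∘ (extChartAt I z).symm) y) +
          𝒞.rdtLowerV b h z (y, U x, fderiv ℝ (U ∘ (extChartAt I z).symm) y) -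
          𝒞.coeffFun z y (fderiv ℝ (U ∘ (extChartAt I z).symm) y
            (𝒞.czVec b z (y, U x, fderiv ℝ (U ∘ (extChartAt I z).symm) y)))) := by
    by_cases hρ : 𝒞.ρ k x = 0
    · have h0 : ∀ s : Π x' : M, TangentSpace I x' →L[ℝ] TangentSpace I x' →L[ℝ] ℝ,
          𝒞.embed s x k = 0 := fun s ↦ by
        change 𝒞.ρ k x • pullCLM (𝒞.σ k x) (s x) = 0
        rw [hρ, zero_smul]
      rw [h0, h0, sub_zero, hρ, zero_smul]
    · have hk : x ∈ (chartAt H (𝒞.center k)).source := 𝒞.mem_source_of_ne_zero hρ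
      have hσ := 𝒞.σ_eq_trivSymmL_comp_tangentCoordChange hk hx
      have h1 : 𝒞.embed (rdtForm g h) x k = 𝒞.ρ k x •
          pullCLM (tangentCoordChange I (𝒞.center k) z x)
            (𝒞.coeffFun z y (𝒞.lap b z U x) +
              𝒞.principalExtra b z (y, U x, fderiv ℝ (U ∘ (extChartAt I z).symm) y) +
              𝒞.rdtLowerV b h z (y, U x, fderiv ℝ (U ∘ (extChartAt I z).symm) y)) := by
        change 𝒞.ρ k x • pullCLM (𝒞.σ k x) (rdtForm g h x) = _
        rw [hσ, pullCLM_comp, hrdt]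
      have h2' : 𝒞.embed (𝒞.assemble (𝒞.D0 b U)) x k = 𝒞.ρ k x •
          pullCLM (tangentCoordChange I (𝒞.center k) z x)
            (𝒞.coeffFun z y (𝒞.lap b z U x) + 𝒞.coeffFun z y (fderiv ℝ (U ∘ (extChartAt I z).symm) y
              (𝒞.czVec b z (y, U x, fderiv ℝ (U ∘ (extChartAt I z).symm) y)))) := by
        change 𝒞.ρ k x • pullCLM (𝒞.σ k x) (𝒞.assembleAt (𝒞.D0 b U x) x) = _
        rw [hσ, pullCLM_comp, pullCLM_trivSymmL_assembleAt, hD0, map_add]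
        rfl
      rw [h1, h2', ← smul_sub, ← map_sub]
      congr 2
      abel
  rw [hdiff, hD0, hlap, fCoef]
  simp only [Pi.add_apply]
  rw [add_assoc]

end Structure

/-! ### Smoothness of the explicit lower-order expression `rdtLower` in its data -/

section RdtLowerSmooth

variable {X : Type*} [NormedAddCommGroup X] [NormedSpace ℝ X] {n : ℕ∞ω}

omit [IsManifold I ∞ M] [DecidableEq ι] in
/-- **`rdtLower` is smooth in its data**: if the components `A`, the inverse Gram entries `Gi`,
the first derivative `D`, the background Christoffel vectors on basis pairs `C(bᵢ, bⱼ)` and their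
derivatives `DC(V, bᵢ, bⱼ)` are `C^n` functions of a parameter, so is
`rdtLower b A Gi D C DC (X₀, Y₀)` (a polynomial expression in these data, `RicciDeTurckCoord.lean`).
[folklore] -/
theorem contDiffAt_rdtLower {A : X → E →L[ℝ] E →L[ℝ] ℝ} {Gi : X → Matrix ι ι ℝ}
    {D : X → E →L[ℝ] E →L[ℝ] E →L[ℝ] ℝ} {C : X → E → E → E} {DC : X → E → E → E → E} {x₀ : X}
    (hA : ContDiffAt ℝ n A x₀) (hGi : ∀ i j, ContDiffAt ℝ n (fun x ↦ Gi x i j) x₀)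
    (hD : ContDiffAt ℝ n D x₀) (hC : ∀ i j, ContDiffAt ℝ n (fun x ↦ C x (b i) (b j)) x₀)
    (hDC : ∀ (V : E) i j, ContDiffAt ℝ n (fun x ↦ DC x V (b i) (b j)) x₀) (X₀ Y₀ : E) :
    ContDiffAt ℝ n (fun x ↦ rdtLower b (A x) (Gi x) (D x) (C x) (DC x) X₀ Y₀) x₀ := by
  simp only [rdtLower, ricLower, lieLowerHalf, wflat, chris, kos, dGramInv, Matrix.of_apply]
  fun_prop (disch := assumption)

end RdtLowerSmooth

/-! ### The jet domain and smoothness of the coefficients -/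

section Smoothness

variable [I.Boundaryless] [FiniteDimensional ℝ E]

/-- **The jet domain** of the chart at `z`: jets `(y, w, p)` with `y` in the chart target and
`(φ_z⁻¹ y, w)` admissible. [folklore] -/
def jetDom (z : M) :
    Set (E × (Fin N → (E →L[ℝ] E →L[ℝ] ℝ)) × (E →L[ℝ] (Fin N → (E →L[ℝ] E →L[ℝ] ℝ)))) :=
  {j | j.1 ∈ (extChartAt I z).target ∧ ((extChartAt I z).symm j.1, j.2.1) ∈ 𝒞.posSet}

/-- The jet domain is open. [folklore] -/
theorem isOpen_jetDom (z : M) : IsOpen (𝒞.jetDom z) := by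
  have hc : ContinuousOn
      (fun j : E × (Fin N → (E →L[ℝ] E →L[ℝ] ℝ)) × (E →L[ℝ] (Fin N → (E →L[ℝ] E →L[ℝ] ℝ))) ↦
        (((extChartAt I z).symm j.1, j.2.1) : M × (Fin N → (E →L[ℝ] E →L[ℝ] ℝ))))
      {j | j.1 ∈ (extChartAt I z).target} :=
    ((continuousOn_extChartAt_symm z).comp continuousOn_fst fun j hj ↦ hj).prodMk
      continuousOn_snd.fst
  have ho : IsOpen {j : E × (Fin N → (E →L[ℝ] E →L[ℝ] ℝ)) × (E →L[ℝ] (Fin N → (E →L[ℝ] E →L[ℝ] ℝ))) |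
      j.1 ∈ (extChartAt I z).target} :=
    (isOpen_extChartAt_target z).preimage continuous_fst
  exact hc.isOpen_inter_preimage ho 𝒞.isOpen_posSet

omit [IsManifold I ∞ M] [FiniteDimensional ℝ E] in
/-- A positive definite form has an invertible Gram matrix (it is nondegenerate; Mathlib's
`LinearMap.BilinForm.nondegenerate_iff_det_ne_zero`). [folklore] -/
theorem det_gram_ne_zero_of_posDef {A : E →L[ℝ] E →L[ℝ] ℝ} (hpos : ∀ v : E, v ≠ 0 → 0 < A v v) :
    (Matrix.of fun i j ↦ A (b i) (b j)).det ≠ 0 := by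
  set B : LinearMap.BilinForm ℝ E := (ContinuousLinearMap.coeLM ℝ).comp A.toLinearMap with hB
  have hB_apply : ∀ v w, B v w = A v w := fun v w ↦ rfl
  have hsep : ∀ v : E, (∀ w, B v w = 0) → v = 0 := fun v hv ↦ by
    by_contra h0
    exact (hpos v h0).ne' (hv v)
  have hsep' : ∀ w : E, (∀ v, B v w = 0) → w = 0 := fun w hw ↦ by
    by_contra h0
    exact (hpos w h0).ne' (hw w)
  have hnd : B.Nondegenerate := ⟨fun v hv ↦ hsep v hv, fun w hw ↦ hsep' w hw⟩
  have h := (LinearMap.BilinForm.nondegenerate_iff_det_ne_zero b).1 hnd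
  convert h using 2
  ext i j
  rw [Matrix.of_apply, LinearMap.BilinForm.toMatrix_apply, hB_apply]

omit [I.Boundaryless] [FiniteDimensional ℝ E] in
/-- At a jet of the jet domain: the base point lies in the chart domain, the components are
positive definite, hence have invertible Gram matrix. [folklore] -/
theorem jetDom_facts {z : M}
    {j₀ : E × (Fin N → (E →L[ℝ] E →L[ℝ] ℝ)) × (E →L[ℝ] (Fin N → (E →L[ℝ] E →L[ℝ] ℝ)))}
    (hj₀ : j₀ ∈ 𝒞.jetDom z) :
    (extChartAt I z).symm j₀.1 ∈ (chartAt H z).source ∧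
      (∀ a : E, a ≠ 0 → 0 < 𝒞.gComp z j₀ a a) ∧
      (Matrix.of fun i j ↦ 𝒞.gComp z j₀ (b i) (b j)).det ≠ 0 := by
  have hx : (extChartAt I z).symm j₀.1 ∈ (chartAt H z).source := by
    rw [← _root_.extChartAt_source I]
    exact (extChartAt I z).map_target hj₀.1
  have hpos : ∀ a : E, a ≠ 0 → 0 < 𝒞.gComp z j₀ a a :=
    (𝒞.mem_posSet_iff_coeffCLM hx j₀.2.1).1 hj₀.2
  exact ⟨hx, hpos, det_gram_ne_zero_of_posDef b hpos⟩

omit [FiniteDimensional ℝ E] in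
/-- **Smoothness of the coefficient map through the jet.** [folklore] -/
theorem contDiffAt_coeffFun_jet₀ {z : M}
    {j₀ : E × (Fin N → (E →L[ℝ] E →L[ℝ] ℝ)) × (E →L[ℝ] (Fin N → (E →L[ℝ] E →L[ℝ] ℝ)))}
    (hj₀ : j₀ ∈ 𝒞.jetDom z) :
    ContDiffAt ℝ ∞ (fun j : E × (Fin N → (E →L[ℝ] E →L[ℝ] ℝ)) ×
        (E →L[ℝ] (Fin N → (E →L[ℝ] E →L[ℝ] ℝ))) ↦ 𝒞.coeffFun z j.1) j₀ :=
  ((𝒞.contDiffOn_coeffCLM_symm z).contDiffAt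
    ((isOpen_extChartAt_target (I := I) z).mem_nhds hj₀.1)).comp j₀ contDiffAt_fst

set_option synthInstance.maxHeartbeats 400000 in
set_option maxSynthPendingDepth 4 in
-- deep operator spaces `E →L ((Fin N → V) →L V)`
omit [FiniteDimensional ℝ E] in
/-- **Smoothness of the first derivative of the coefficient map through the jet.** [folklore] -/
theorem contDiffAt_coeffFun_jet₁ {z : M}
    {j₀ : E × (Fin N → (E →L[ℝ] E →L[ℝ] ℝ)) × (E →L[ℝ] (Fin N → (E →L[ℝ] E →L[ℝ] ℝ)))}
    (hj₀ : j₀ ∈ 𝒞.jetDom z) :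
    ContDiffAt ℝ ∞ (fun j : E × (Fin N → (E →L[ℝ] E →L[ℝ] ℝ)) ×
        (E →L[ℝ] (Fin N → (E →L[ℝ] E →L[ℝ] ℝ))) ↦ fderiv ℝ (𝒞.coeffFun z) j.1) j₀ := by
  have hopen := isOpen_extChartAt_target (I := I) z
  have h1 : ContDiffOn ℝ ∞ (fderiv ℝ (𝒞.coeffFun z)) (extChartAt I z).target :=
    (𝒞.contDiffOn_coeffCLM_symm z).fderiv_of_isOpen hopen le_rfl
  exact (h1.contDiffAt (hopen.mem_nhds hj₀.1)).comp j₀ contDiffAt_fst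

set_option synthInstance.maxHeartbeats 400000 in
set_option maxSynthPendingDepth 4 in
-- deep operator spaces `E →L E →L ((Fin N → V) →L V)`
set_option maxHeartbeats 400000 in
omit [FiniteDimensional ℝ E] in
/-- **Smoothness of the second derivative of the coefficient map through the jet.** [folklore] -/
theorem contDiffAt_coeffFun_jet₂ {z : M}
    {j₀ : E × (Fin N → (E →L[ℝ] E →L[ℝ] ℝ)) × (E →L[ℝ] (Fin N → (E →L[ℝ] E →L[ℝ] ℝ)))}
    (hj₀ : j₀ ∈ 𝒞.jetDom z) :
    ContDiffAt ℝ ∞ (fun j : E × (Fin N → (E →L[ℝ] E →L[ℝ] ℝ)) ×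
        (E →L[ℝ] (Fin N → (E →L[ℝ] E →L[ℝ] ℝ))) ↦ fderiv ℝ (fderiv ℝ (𝒞.coeffFun z)) j.1) j₀ := by
  have hopen := isOpen_extChartAt_target (I := I) z
  have h1 : ContDiffOn ℝ ∞ (fderiv ℝ (𝒞.coeffFun z)) (extChartAt I z).target :=
    (𝒞.contDiffOn_coeffCLM_symm z).fderiv_of_isOpen hopen le_rfl
  have h2 : ContDiffOn ℝ ∞ (fderiv ℝ (fderiv ℝ (𝒞.coeffFun z))) (extChartAt I z).target :=
    h1.fderiv_of_isOpen hopen le_rfl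
  exact (h2.contDiffAt (hopen.mem_nhds hj₀.1)).comp j₀ contDiffAt_fst

variable [CompleteSpace E]

omit [CompleteSpace E] in
/-- **Smoothness of the background Christoffel data through the jet.** [folklore] -/
theorem contDiffAt_bgChris_jet {z : M}
    {j₀ : E × (Fin N → (E →L[ℝ] E →L[ℝ] ℝ)) × (E →L[ℝ] (Fin N → (E →L[ℝ] E →L[ℝ] ℝ)))}
    (hj₀ : j₀ ∈ 𝒞.jetDom z) (Y₁ X₁ : E) :
    ContDiffAt ℝ ∞ (fun j : E × (Fin N → (E →L[ℝ] E →L[ℝ] ℝ)) ×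
        (E →L[ℝ] (Fin N → (E →L[ℝ] E →L[ℝ] ℝ))) ↦ bgChris I b h z j.1 Y₁ X₁) j₀ ∧
      ∀ V : E, ContDiffAt ℝ ∞ (fun j : E × (Fin N → (E →L[ℝ] E →L[ℝ] ℝ)) ×
        (E →L[ℝ] (Fin N → (E →L[ℝ] E →L[ℝ] ℝ))) ↦
          fderiv ℝ (fun y' : E ↦ bgChris I b h z y' Y₁ X₁) j.1 V) j₀ := by
  have hopen := isOpen_extChartAt_target (I := I) z
  have h0 : ContDiffOn ℝ ∞ (fun y ↦ bgChris I b h z y Y₁ X₁) (extChartAt I z).target :=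
    contDiffOn_bgChris b h z Y₁ X₁
  have h1 : ContDiffOn ℝ ∞ (fderiv ℝ fun y ↦ bgChris I b h z y Y₁ X₁) (extChartAt I z).target :=
    h0.fderiv_of_isOpen hopen le_rfl
  have hn : (extChartAt I z).target ∈ 𝓝 j₀.1 := hopen.mem_nhds hj₀.1
  refine ⟨(h0.contDiffAt hn).comp j₀ contDiffAt_fst, fun V ↦ ?_⟩
  exact ((h1.contDiffAt hn).comp j₀ contDiffAt_fst).clm_apply contDiffAt_const

set_option synthInstance.maxHeartbeats 400000 in
set_option maxSynthPendingDepth 4 in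
set_option maxHeartbeats 1600000 in
-- deep operator spaces through the jet `E × W × (E →L W)`
omit [CompleteSpace E] [FiniteDimensional ℝ E] in
/-- **Smoothness of the components, their inverse Gram entries and `DG` through the jet.**
[folklore] -/
theorem contDiffAt_gComp_jet {z : M}
    {j₀ : E × (Fin N → (E →L[ℝ] E →L[ℝ] ℝ)) × (E →L[ℝ] (Fin N → (E →L[ℝ] E →L[ℝ] ℝ)))}
    (hj₀ : j₀ ∈ 𝒞.jetDom z) :
    ContDiffAt ℝ ∞ (𝒞.gComp z) j₀ ∧
      (∀ i j, ContDiffAt ℝ ∞ (fun j' ↦ gramInv b (𝒞.gComp z j') i j) j₀) ∧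
      ContDiffAt ℝ ∞ (𝒞.dG z) j₀ := by
  have h𝔞 := 𝒞.contDiffAt_coeffFun_jet₀ hj₀
  have hD𝔞 := 𝒞.contDiffAt_coeffFun_jet₁ hj₀
  obtain ⟨-, -, hdet⟩ := 𝒞.jetDom_facts b hj₀
  have hG : ContDiffAt ℝ ∞ (𝒞.gComp z) j₀ := h𝔞.clm_apply contDiffAt_snd.fst
  have hGi : ∀ i j, ContDiffAt ℝ ∞ (fun j' ↦ gramInv b (𝒞.gComp z j') i j) j₀ := by
    intro i j
    have hent : ∀ i' j', ContDiffAt ℝ ∞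
        (fun x ↦ (Matrix.of fun i' j' ↦ 𝒞.gComp z x (b i') (b j')) i' j') j₀ := fun i' j' ↦
      (hG.clm_apply contDiffAt_const).clm_apply contDiffAt_const
    have h1 := contMDiffAt_matrix_inv (I := 𝓘(ℝ, E × (Fin N → (E →L[ℝ] E →L[ℝ] ℝ)) ×
      (E →L[ℝ] (Fin N → (E →L[ℝ] E →L[ℝ] ℝ))))) (k := ∞)
      (A := fun x ↦ Matrix.of fun i' j' ↦ 𝒞.gComp z x (b i') (b j')) (x₀ := j₀)
      (fun i' j' ↦ contMDiffAt_iff_contDiffAt.2 (hent i' j')) hdet i j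
    exact contMDiffAt_iff_contDiffAt.1 h1
  refine ⟨hG, hGi, ?_⟩
  -- `dG j = (𝔞 j.1).comp j.2.2 + (D𝔞 j.1).flip j.2.1`
  set Fl : (E →L[ℝ] (Fin N → (E →L[ℝ] E →L[ℝ] ℝ)) →L[ℝ] (E →L[ℝ] E →L[ℝ] ℝ)) →L[ℝ]
      ((Fin N → (E →L[ℝ] E →L[ℝ] ℝ)) →L[ℝ] E →L[ℝ] (E →L[ℝ] E →L[ℝ] ℝ)) :=
    (ContinuousLinearMap.flipₗᵢ ℝ E (Fin N → (E →L[ℝ] E →L[ℝ] ℝ))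
      (E →L[ℝ] E →L[ℝ] ℝ)).toContinuousLinearEquiv.toContinuousLinearMap with hFl
  have hflip : ContDiffAt ℝ ∞ (fun j : E × (Fin N → (E →L[ℝ] E →L[ℝ] ℝ)) ×
      (E →L[ℝ] (Fin N → (E →L[ℝ] E →L[ℝ] ℝ))) ↦ (fderiv ℝ (𝒞.coeffFun z) j.1).flip) j₀ :=
    (Fl.contDiff.contDiffAt).comp j₀ hD𝔞
  have h := (h𝔞.clm_comp contDiffAt_snd.snd).add (hflip.clm_apply contDiffAt_snd.fst)
  exact h

set_option synthInstance.maxHeartbeats 400000 in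
set_option maxSynthPendingDepth 4 in
set_option maxHeartbeats 1600000 in
-- deep operator spaces through the jet `E × W × (E →L W)`
omit [CompleteSpace E] in
/-- **Smoothness of `rdtLowerV`, `d2GExtra`, `principalExtra` through the jet.** [folklore] -/
theorem contDiffAt_lowerTerms_jet [h.HasLeviCivita] {z : M}
    {j₀ : E × (Fin N → (E →L[ℝ] E →L[ℝ] ℝ)) × (E →L[ℝ] (Fin N → (E →L[ℝ] E →L[ℝ] ℝ)))}
    (hj₀ : j₀ ∈ 𝒞.jetDom z) :
    ContDiffAt ℝ ∞ (𝒞.rdtLowerV b h z) j₀ ∧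
      (∀ i i', ContDiffAt ℝ ∞ (fun j ↦ 𝒞.d2GExtra b z j i i') j₀) ∧
      ContDiffAt ℝ ∞ (𝒞.principalExtra b z) j₀ := by
  have h𝔞 := 𝒞.contDiffAt_coeffFun_jet₀ hj₀
  have hD𝔞 := 𝒞.contDiffAt_coeffFun_jet₁ hj₀
  have hD2𝔞 := 𝒞.contDiffAt_coeffFun_jet₂ hj₀
  obtain ⟨hG, hGi, hdG⟩ := 𝒞.contDiffAt_gComp_jet b hj₀
  have hΓ := fun Y₁ X₁ ↦ (𝒞.contDiffAt_bgChris_jet b h hj₀ Y₁ X₁).1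
  have hDΓ := fun Y₁ X₁ ↦ (𝒞.contDiffAt_bgChris_jet b h hj₀ Y₁ X₁).2
  have hlow : ∀ c d, ContDiffAt ℝ ∞ (fun j ↦
      rdtLower b (𝒞.gComp z j) (gramInv b (𝒞.gComp z j)) (𝒞.dG z j) (bgChris I b h z j.1)
        (fun V Y₁ X₁ ↦ fderiv ℝ (fun y' : E ↦ bgChris I b h z y' Y₁ X₁) j.1 V) (b c) (b d)) j₀ :=
    fun c d ↦ contDiffAt_rdtLower b hG hGi hdG (fun i j ↦ hΓ (b i) (b j))
      (fun V i j ↦ hDΓ (b i) (b j) V) (b c) (b d)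
  have hrV : ContDiffAt ℝ ∞ (𝒞.rdtLowerV b h z) j₀ := by
    -- `bilinOfCoeffs b f = (∑ f c i • T c i).flip` with constant forms `T c i`
    have hS : ContDiffAt ℝ ∞ (fun j ↦ ∑ c, ∑ i,
        rdtLower b (𝒞.gComp z j) (gramInv b (𝒞.gComp z j)) (𝒞.dG z j) (bgChris I b h z j.1)
          (fun V Y₁ X₁ ↦ fderiv ℝ (fun y' : E ↦ bgChris I b h z y' Y₁ X₁) j.1 V) (b c) (b i) •
          (((ContinuousLinearMap.mul ℝ ℝ).comp (b.coord c).toContinuousLinearMap).flip.comp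
            (b.coord i).toContinuousLinearMap)) j₀ := by
      fun_prop (disch := assumption)
    set Flv : (E →L[ℝ] E →L[ℝ] ℝ) →L[ℝ] (E →L[ℝ] E →L[ℝ] ℝ) :=
      (ContinuousLinearMap.flipₗᵢ ℝ E E ℝ).toContinuousLinearEquiv.toContinuousLinearMap with hFlv
    have heq : 𝒞.rdtLowerV b h z = fun j ↦ Flv (∑ c, ∑ i,
        rdtLower b (𝒞.gComp z j) (gramInv b (𝒞.gComp z j)) (𝒞.dG z j) (bgChris I b h z j.1)
          (fun V Y₁ X₁ ↦ fderiv ℝ (fun y' : E ↦ bgChris I b h z y' Y₁ X₁) j.1 V) (b c) (b i) •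
          (((ContinuousLinearMap.mul ℝ ℝ).comp (b.coord c).toContinuousLinearMap).flip.comp
            (b.coord i).toContinuousLinearMap)) := rfl
    rw [heq]
    exact Flv.contDiff.contDiffAt.comp j₀ hS
  have hd2 : ∀ i i', ContDiffAt ℝ ∞ (fun j ↦ 𝒞.d2GExtra b z j i i') j₀ := by
    intro i i'
    unfold d2GExtra
    fun_prop (disch := assumption)
  refine ⟨hrV, hd2, ?_⟩
  unfold principalExtra
  fun_prop (disch := assumption)

omit [I.Boundaryless] [FiniteDimensional ℝ E] [CompleteSpace E] in
/-- **The transition transfer map is smooth on the chart domain**: the map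
`x ↦ ρₖ(x) · pullCLM (tangentCoordChange I cₖ z x)` (each term is locally either zero or `ρₖ`
times the linear pullback along the smooth coordinate change of `TM`). [folklore] -/
theorem contMDiffOn_transfer (k : Fin N) (z : M) :
    ContMDiffOn I 𝓘(ℝ, (E →L[ℝ] E →L[ℝ] ℝ) →L[ℝ] (E →L[ℝ] E →L[ℝ] ℝ)) ∞
      (fun x ↦ 𝒞.ρ k x • pullCLM (tangentCoordChange I (𝒞.center k) z x)) (chartAt H z).source := by
  intro x₀ hx₀
  have hb₀ : x₀ ∈ (trivializationAt E (TangentSpace I : M → Type _) z).baseSet :=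
    mem_baseSet_of_mem_source hx₀
  have hρ : ContMDiffWithinAt I 𝓘(ℝ, ℝ) ∞ (𝒞.ρ k) (chartAt H z).source x₀ :=
    (𝒞.contMDiff_ρ k).contMDiffAt.contMDiffWithinAt
  by_cases hk : x₀ ∈ tsupport (𝒞.ρ k)
  · have hsrc : x₀ ∈ (chartAt H (𝒞.center k)).source := 𝒞.tsupport_subset k hk
    have hbk : x₀ ∈ (trivializationAt E (TangentSpace I : M → Type _) (𝒞.center k)).baseSet :=
      mem_baseSet_of_mem_source hsrc
    have hcc : ContMDiffWithinAt I 𝓘(ℝ, E →L[ℝ] E) ∞ (fun x ↦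
        ((trivializationAt E (TangentSpace I : M → Type _) (𝒞.center k)).coordChangeL ℝ
          (trivializationAt E (TangentSpace I : M → Type _) z) x : E →L[ℝ] E))
        (chartAt H z).source x₀ := contMDiffWithinAt_id.coordChangeL hbk hb₀
    have hpull : ContMDiffWithinAt I 𝓘(ℝ, (E →L[ℝ] E →L[ℝ] ℝ) →L[ℝ] (E →L[ℝ] E →L[ℝ] ℝ)) ∞
        (fun x ↦ pullCLM ((trivializationAt E (TangentSpace I : M → Type _)
          (𝒞.center k)).coordChangeL ℝ (trivializationAt E (TangentSpace I : M → Type _) z) x :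
            E →L[ℝ] E)) (chartAt H z).source x₀ :=
      (contDiff_pullCLM (E := E) (F := E)).contDiffAt.comp_contMDiffWithinAt hcc
    have hpt : ∀ x, x ∈ (chartAt H (𝒞.center k)).source ∩ (chartAt H z).source →
        𝒞.ρ k x • pullCLM (tangentCoordChange I (𝒞.center k) z x) =
        (𝒞.ρ k • fun x ↦ pullCLM ((trivializationAt E (TangentSpace I : M → Type _)
          (𝒞.center k)).coordChangeL ℝ (trivializationAt E (TangentSpace I : M → Type _) z) x :
            E →L[ℝ] E)) x := by
      intro x hx
      simp only [Pi.smul_apply']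
      rw [← trivCLM_comp_trivSymmL_eq_tangentCoordChange hx.1 hx.2, trivCLM_comp_trivSymmL hx.1 hx.2]
    refine (hρ.smul hpull).congr_of_eventuallyEq ?_ (hpt x₀ ⟨hsrc, hx₀⟩)
    have hev : ∀ᶠ x in 𝓝[(chartAt H z).source] x₀,
        x ∈ (chartAt H (𝒞.center k)).source ∩ (chartAt H z).source :=
      mem_nhdsWithin_of_mem_nhds
        (((chartAt H _).open_source.inter (chartAt H _).open_source).mem_nhds ⟨hsrc, hx₀⟩)
    filter_upwards [hev] with x hx
    exact hpt x hx
  · have h0 : ∀ᶠ y in 𝓝 x₀, 𝒞.ρ k y = 0 := notMem_tsupport_iff_eventuallyEq.1 hk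
    have hz : ∀ T : (E →L[ℝ] E →L[ℝ] ℝ) →L[ℝ] (E →L[ℝ] E →L[ℝ] ℝ), (0 : ℝ) • T = 0 :=
      fun T ↦ zero_smul ℝ T
    refine (contMDiffWithinAt_const (c := (0 : (E →L[ℝ] E →L[ℝ] ℝ) →L[ℝ]
      (E →L[ℝ] E →L[ℝ] ℝ)))).congr_of_eventuallyEq ?_ ?_
    · filter_upwards [mem_nhdsWithin_of_mem_nhds h0] with x hx
      rw [show 𝒞.ρ k x = 0 from hx]
      exact hz _
    · rw [show 𝒞.ρ k x₀ = 0 from h0.self_of_nhds]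
      exact hz _

omit [I.Boundaryless] [FiniteDimensional ℝ E] [CompleteSpace E] in
/-- The transfer map read on the chart target is smooth. [folklore] -/
theorem contDiffOn_transfer_symm (k : Fin N) (z : M) :
    ContDiffOn ℝ ∞ (fun y ↦ 𝒞.ρ k ((extChartAt I z).symm y) •
      pullCLM (tangentCoordChange I (𝒞.center k) z ((extChartAt I z).symm y)))
      (extChartAt I z).target := by
  rw [← contMDiffOn_iff_contDiffOn]
  refine (𝒞.contMDiffOn_transfer k z).comp (contMDiffOn_extChartAt_symm z) fun y hy ↦ ?_
  rw [← _root_.extChartAt_source I]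
  exact (extChartAt I z).map_target hy

set_option synthInstance.maxHeartbeats 400000 in
set_option maxSynthPendingDepth 4 in
set_option maxHeartbeats 1600000 in
-- deep operator spaces through the jet `E × W × (E →L W)`
omit [CompleteSpace E] [FiniteDimensional ℝ E] in
/-- **Smoothness of the correction vector `czVec` through the jet** (term by term in `k`: near a
jet whose base point lies outside the support of `ρₖ` the term vanishes identically; otherwise
the base point lies in the chart domain of `cₖ`, where the tangent coordinate change, the second
derivative of the transition map and the inverse Gram entries of the pulled-back components are
smooth). [folklore] -/
theorem contDiffAt_czVec {z : M}
    {j₀ : E × (Fin N → (E →L[ℝ] E →L[ℝ] ℝ)) × (E →L[ℝ] (Fin N → (E →L[ℝ] E →L[ℝ] ℝ)))}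
    (hj₀ : j₀ ∈ 𝒞.jetDom z) : ContDiffAt ℝ ∞ (𝒞.czVec b z) j₀ := by
  obtain ⟨hx₀, hpos, -⟩ := 𝒞.jetDom_facts b hj₀
  obtain ⟨hG, -, -⟩ := 𝒞.contDiffAt_gComp_jet b hj₀
  set x₀ := (extChartAt I z).symm j₀.1 with hx₀def
  have hy₀ : j₀.1 ∈ (extChartAt I z).target := hj₀.1
  have hyx₀ : extChartAt I z x₀ = j₀.1 := (extChartAt I z).right_inv hy₀
  -- the base map `j ↦ φ_z⁻¹ j.1` is continuous at `j₀`
  have hbase : ContinuousAt (fun j : E × (Fin N → (E →L[ℝ] E →L[ℝ] ℝ)) ×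
      (E →L[ℝ] (Fin N → (E →L[ℝ] E →L[ℝ] ℝ))) ↦ (extChartAt I z).symm j.1) j₀ :=
    (continuousAt_extChartAt_symm'' hy₀).comp continuousAt_fst
  unfold czVec
  refine ContDiffAt.sum fun k _ ↦ ?_
  by_cases hk : x₀ ∈ tsupport (𝒞.ρ k)
  · -- the base point lies in the chart domain of `cₖ`
    have hsrc : x₀ ∈ (chartAt H (𝒞.center k)).source := 𝒞.tsupport_subset k hk
    -- `ρₖ ∘ φ_z⁻¹ ∘ fst` is smooth at `j₀`
    have hρy : ContDiffAt ℝ ∞ (fun y ↦ 𝒞.ρ k ((extChartAt I z).symm y)) j₀.1 := by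
      have h1 : ContMDiffOn 𝓘(ℝ, E) 𝓘(ℝ, ℝ) ∞ (fun y ↦ 𝒞.ρ k ((extChartAt I z).symm y))
          (extChartAt I z).target :=
        (𝒞.contMDiff_ρ k).comp_contMDiffOn (contMDiffOn_extChartAt_symm z)
      exact contMDiffAt_iff_contDiffAt.1 (h1.contMDiffAt ((isOpen_extChartAt_target z).mem_nhds hy₀))
    have hρ : ContDiffAt ℝ ∞ (fun j : E × (Fin N → (E →L[ℝ] E →L[ℝ] ℝ)) ×
        (E →L[ℝ] (Fin N → (E →L[ℝ] E →L[ℝ] ℝ))) ↦ 𝒞.ρ k ((extChartAt I z).symm j.1)) j₀ :=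
      hρy.comp j₀ contDiffAt_fst
    -- the tangent coordinate change `Aₖ ∘ φ_z⁻¹ ∘ fst` is smooth at `j₀`
    have hAM : ContMDiffAt I 𝓘(ℝ, E →L[ℝ] E) ∞ (fun x ↦ tangentCoordChange I (𝒞.center k) z x) x₀ := by
      have hbk : x₀ ∈ (trivializationAt E (TangentSpace I : M → Type _) (𝒞.center k)).baseSet :=
        mem_baseSet_of_mem_source hsrc
      have hbz : x₀ ∈ (trivializationAt E (TangentSpace I : M → Type _) z).baseSet :=
        mem_baseSet_of_mem_source hx₀
      have hcc : ContMDiffAt I 𝓘(ℝ, E →L[ℝ] E) ∞ (fun x ↦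
          ((trivializationAt E (TangentSpace I : M → Type _) (𝒞.center k)).coordChangeL ℝ
            (trivializationAt E (TangentSpace I : M → Type _) z) x : E →L[ℝ] E)) x₀ :=
        contMDiffAt_id.coordChangeL hbk hbz
      refine hcc.congr_of_eventuallyEq ?_
      have hev : ∀ᶠ x in 𝓝 x₀, x ∈ (chartAt H (𝒞.center k)).source ∩ (chartAt H z).source :=
        ((chartAt H _).open_source.inter (chartAt H _).open_source).mem_nhds ⟨hsrc, hx₀⟩
      filter_upwards [hev] with x hx
      rw [← trivCLM_comp_trivSymmL_eq_tangentCoordChange hx.1 hx.2, trivCLM_comp_trivSymmL hx.1 hx.2]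
    have hAy : ContDiffAt ℝ ∞ (fun y ↦ tangentCoordChange I (𝒞.center k) z ((extChartAt I z).symm y))
        j₀.1 := by
      have hsy : ContMDiffAt 𝓘(ℝ, E) I ∞ (extChartAt I z).symm j₀.1 :=
        (contMDiffOn_extChartAt_symm z).contMDiffAt ((isOpen_extChartAt_target z).mem_nhds hy₀)
      exact contMDiffAt_iff_contDiffAt.1 (hAM.comp j₀.1 hsy)
    have hA : ContDiffAt ℝ ∞ (fun j : E × (Fin N → (E →L[ℝ] E →L[ℝ] ℝ)) ×
        (E →L[ℝ] (Fin N → (E →L[ℝ] E →L[ℝ] ℝ))) ↦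
          tangentCoordChange I (𝒞.center k) z ((extChartAt I z).symm j.1)) j₀ :=
      hAy.comp j₀ contDiffAt_fst
    -- the pulled-back components and their inverse Gram entries
    have hGk : ContDiffAt ℝ ∞ (fun j : E × (Fin N → (E →L[ℝ] E →L[ℝ] ℝ)) ×
        (E →L[ℝ] (Fin N → (E →L[ℝ] E →L[ℝ] ℝ))) ↦
          pullCLM (tangentCoordChange I (𝒞.center k) z ((extChartAt I z).symm j.1)) (𝒞.gComp z j))
        j₀ :=
      ((contDiff_pullCLM (E := E) (F := E)).contDiffAt.comp j₀ hA).clm_apply hG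
    have hGk0 : pullCLM (tangentCoordChange I (𝒞.center k) z x₀) (𝒞.gComp z j₀) =
        𝒞.coeffCLM (𝒞.center k) x₀ j₀.2.1 :=
      (𝒞.coeffCLM_center_eq_pullCLM hsrc hx₀ j₀.2.1).symm
    have hposk : ∀ a : E, a ≠ 0 →
        0 < pullCLM (tangentCoordChange I (𝒞.center k) z x₀) (𝒞.gComp z j₀) a a := by
      rw [hGk0]
      exact (𝒞.mem_posSet_iff_coeffCLM hsrc j₀.2.1).1 hj₀.2
    have hdetk := det_gram_ne_zero_of_posDef b hposk
    have hGik : ∀ i j, ContDiffAt ℝ ∞ (fun j' : E × (Fin N → (E →L[ℝ] E →L[ℝ] ℝ)) ×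
        (E →L[ℝ] (Fin N → (E →L[ℝ] E →L[ℝ] ℝ))) ↦ gramInv b
          (pullCLM (tangentCoordChange I (𝒞.center k) z ((extChartAt I z).symm j'.1))
            (𝒞.gComp z j')) i j) j₀ := by
      intro i j
      have hent : ∀ i' j', ContDiffAt ℝ ∞ (fun j'' ↦ (Matrix.of fun i' j' ↦
          pullCLM (tangentCoordChange I (𝒞.center k) z ((extChartAt I z).symm j''.1))
            (𝒞.gComp z j'') (b i') (b j')) i' j') j₀ := fun i' j' ↦
        (hGk.clm_apply contDiffAt_const).clm_apply contDiffAt_const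
      have h1 := contMDiffAt_matrix_inv (I := 𝓘(ℝ, E × (Fin N → (E →L[ℝ] E →L[ℝ] ℝ)) ×
        (E →L[ℝ] (Fin N → (E →L[ℝ] E →L[ℝ] ℝ))))) (k := ∞)
        (A := fun j'' ↦ Matrix.of fun i' j' ↦
          pullCLM (tangentCoordChange I (𝒞.center k) z ((extChartAt I z).symm j''.1))
            (𝒞.gComp z j'') (b i') (b j')) (x₀ := j₀)
        (fun i' j' ↦ contMDiffAt_iff_contDiffAt.2 (hent i' j')) hdetk i j
      exact contMDiffAt_iff_contDiffAt.1 h1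
    -- the second derivative of the transition map along the reverse transition
    have hτ2 : ContDiffAt ℝ ∞ (fun y ↦ fderiv ℝ (fderiv ℝ (extChartAt I z ∘ (extChartAt I (𝒞.center k)).symm))
        (extChartAt I (𝒞.center k) ((extChartAt I z).symm y))) j₀.1 := by
      have hτ : ContDiffAt ℝ ∞ (extChartAt I z ∘ (extChartAt I (𝒞.center k)).symm)
          (extChartAt I (𝒞.center k) x₀) := contDiffAt_transition hsrc hx₀ le_rfl
      have hτ' : ContDiffAt ℝ ∞ (fderiv ℝ (fderiv ℝ (extChartAt I z ∘ (extChartAt I (𝒞.center k)).symm)))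
          (extChartAt I (𝒞.center k) x₀) :=
        (hτ.fderiv_right le_rfl).fderiv_right le_rfl
      have hσ : ContDiffAt ℝ ∞ (extChartAt I (𝒞.center k) ∘ (extChartAt I z).symm) (extChartAt I z x₀) :=
        contDiffAt_transition hx₀ hsrc le_rfl
      rw [hyx₀] at hσ
      have hpt : (extChartAt I (𝒞.center k) ∘ (extChartAt I z).symm) j₀.1 = extChartAt I (𝒞.center k) x₀ := rfl
      rw [← hpt] at hτ'
      exact hτ'.comp j₀.1 hσ
    have hτ2j : ContDiffAt ℝ ∞ (fun j : E × (Fin N → (E →L[ℝ] E →L[ℝ] ℝ)) ×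
        (E →L[ℝ] (Fin N → (E →L[ℝ] E →L[ℝ] ℝ))) ↦
          fderiv ℝ (fderiv ℝ (extChartAt I z ∘ (extChartAt I (𝒞.center k)).symm))
            (extChartAt I (𝒞.center k) ((extChartAt I z).symm j.1))) j₀ :=
      hτ2.comp j₀ contDiffAt_fst
    unfold cvec
    fun_prop (disch := assumption)
  · -- the term vanishes near `j₀`
    have h0 : ∀ᶠ y in 𝓝 x₀, 𝒞.ρ k y = 0 := notMem_tsupport_iff_eventuallyEq.1 hk
    have hev : ∀ᶠ j in 𝓝 j₀, 𝒞.ρ k ((extChartAt I z).symm j.1) = 0 := hbase.eventually h0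
    refine (contDiffAt_const (c := (0 : E))).congr_of_eventuallyEq ?_
    filter_upwards [hev] with j hj
    rw [hj, zero_pow two_ne_zero, zero_smul]

set_option synthInstance.maxHeartbeats 400000 in
set_option maxSynthPendingDepth 4 in
set_option maxHeartbeats 1600000 in
-- deep operator spaces through the jet `E × W × (E →L W)`
omit [CompleteSpace E] in
/-- **Smoothness of the lower-order coefficient `fCoef` on the jet domain.** [folklore] -/
theorem contDiffOn_fCoef [h.HasLeviCivita] (z : M) : ContDiffOn ℝ ∞ (𝒞.fCoef b h z) (𝒞.jetDom z) := by
  intro j₀ hj₀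
  refine ContDiffAt.contDiffWithinAt ?_
  have h𝔞 := 𝒞.contDiffAt_coeffFun_jet₀ hj₀
  obtain ⟨hrV, -, hpE⟩ := 𝒞.contDiffAt_lowerTerms_jet b h hj₀
  have hcz := 𝒞.contDiffAt_czVec b hj₀
  have hy₀ : j₀.1 ∈ (extChartAt I z).target := hj₀.1
  have htr : ∀ k, ContDiffAt ℝ ∞ (fun j : E × (Fin N → (E →L[ℝ] E →L[ℝ] ℝ)) ×
      (E →L[ℝ] (Fin N → (E →L[ℝ] E →L[ℝ] ℝ))) ↦ 𝒞.ρ k ((extChartAt I z).symm j.1) •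
        pullCLM (tangentCoordChange I (𝒞.center k) z ((extChartAt I z).symm j.1))) j₀ := fun k ↦
    ((𝒞.contDiffOn_transfer_symm k z).contDiffAt
      ((isOpen_extChartAt_target z).mem_nhds hy₀)).comp j₀ contDiffAt_fst
  rw [contDiffAt_pi]
  intro k
  have hpcz : ContDiffAt ℝ ∞ (fun j : E × (Fin N → (E →L[ℝ] E →L[ℝ] ℝ)) ×
      (E →L[ℝ] (Fin N → (E →L[ℝ] E →L[ℝ] ℝ))) ↦ j.2.2 (𝒞.czVec b z j)) j₀ :=
    contDiffAt_snd.snd.clm_apply hcz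
  have h1 : ContDiffAt ℝ ∞ (fun j : E × (Fin N → (E →L[ℝ] E →L[ℝ] ℝ)) ×
      (E →L[ℝ] (Fin N → (E →L[ℝ] E →L[ℝ] ℝ))) ↦ j.2.2 (𝒞.czVec b z j) k) j₀ :=
    contDiffAt_pi.1 hpcz k
  have h2 : ContDiffAt ℝ ∞ (fun j : E × (Fin N → (E →L[ℝ] E →L[ℝ] ℝ)) ×
      (E →L[ℝ] (Fin N → (E →L[ℝ] E →L[ℝ] ℝ))) ↦
        (𝒞.ρ k ((extChartAt I z).symm j.1) •
          pullCLM (tangentCoordChange I (𝒞.center k) z ((extChartAt I z).symm j.1)))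
          (𝒞.principalExtra b z j + 𝒞.rdtLowerV b h z j - 𝒞.coeffFun z j.1 (j.2.2 (𝒞.czVec b z j))))
      j₀ :=
    (htr k).clm_apply ((hpE.add hrV).sub (h𝔞.clm_apply hpcz))
  refine (h1.add h2).congr_of_eventuallyEq (Filter.Eventually.of_forall fun j ↦ ?_)
  simp only [fCoef, _root_.smul_apply]

omit [CompleteSpace E] [FiniteDimensional ℝ E] in
/-- **Smoothness of the principal coefficient matrix on the jet domain** (entrywise). [folklore] -/
theorem contDiffOn_aCoef (z : M) (i i' : ι) :
    ContDiffOn ℝ ∞ (fun j ↦ 𝒞.aCoef b z j i i') (𝒞.jetDom z) := fun _ hj₀ ↦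
  ((𝒞.contDiffAt_gComp_jet b hj₀).2.1 i' i).contDiffWithinAt

omit [CompleteSpace E] [I.Boundaryless] [FiniteDimensional ℝ E] in
/-- **The principal coefficient matrix is symmetric** (the components of `𝒜` are symmetric
forms, `assembleAt_symm`, `gramInv_symm`). [folklore] -/
theorem aCoef_symm (z : M)
    (j : E × (Fin N → (E →L[ℝ] E →L[ℝ] ℝ)) × (E →L[ℝ] (Fin N → (E →L[ℝ] E →L[ℝ] ℝ)))) (i i' : ι) :
    𝒞.aCoef b z j i i' = 𝒞.aCoef b z j i' i := by
  unfold aCoef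
  refine gramInv_symm b (fun v w ↦ ?_) i' i
  change 𝒞.coeffCLM z _ j.2.1 v w = 𝒞.coeffCLM z _ j.2.1 w v
  rw [← pullCLM_trivSymmL_assembleAt, pullCLM_apply, pullCLM_apply]
  exact 𝒞.assembleAt_symm _ _ _ _

omit [CompleteSpace E] [I.Boundaryless] [FiniteDimensional ℝ E] in
/-- **The principal coefficient matrix is positive definite on the jet domain** — strict
parabolicity of the vector-valued system, `∑ᵢᵢ' aᵢᵢ' ξᵢ ξᵢ' = g^{i'i} ξᵢ ξᵢ' > 0` for `ξ ≠ 0`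
(`gramInv_quadratic_pos`). [cite: Topping2006, §5.2, Step 1] -/
theorem aCoef_pos (z : M)
    {j : E × (Fin N → (E →L[ℝ] E →L[ℝ] ℝ)) × (E →L[ℝ] (Fin N → (E →L[ℝ] E →L[ℝ] ℝ)))}
    (hj : j ∈ 𝒞.jetDom z) {ξ : ι → ℝ} (hξ : ξ ≠ 0) :
    0 < ∑ i, ∑ i', 𝒞.aCoef b z j i i' * ξ i * ξ i' := by
  obtain ⟨-, hpos, hdet⟩ := 𝒞.jetDom_facts b hj
  exact gramInv_quadratic_pos b hpos hdet hξ

end Smoothness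

end ChartCover

end Literature.Geometry.Riemannian

end
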